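import Mathlib
import Summits.MatrixMultiplication.MatrixMultiplication.Theses.FourierTwoFamiliesModP
import Literature.Computability.AlgebraicComplexity.SimultaneousDoubleProduct

/-!
# `PrimeCyclicPowerGain` refutes the clustered two-families leaf — stub
`stub_leafVersusPowerGain` of line `registered` (clustered-charts reshape, kill-side calibration;
crux `EisensteinValCertificates.HomocyclicSTPPDesigns`, stmt-MatrixMultiplication-10647)

The line's open leaf `stub_clusteredTwoFamilies` asks, for every `ε > 0`, for a prime `p`, an SDPP
family `(A_i, B_i)_{i<n}` in `ℤ/p` (tree `IsSDPP`) with uniform sizes `|A_i| = a`, `|B_i| = b`,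
`ab ≥ 2`, a class map `cls : Fin n → Fin m` with cross-class disjoint difference sets `A_i − B_i`,
all classes of size `≥ d`, and MERIT `m · d^{2/3} · (ab)^{(2+ε)/3} > p`.  The sibling route's kill
item `FourierTwoFamiliesModP.PrimeCyclicPowerGain` (stmt-MatrixMultiplication-14309, OPEN, taken as a
HYPOTHESIS: a fixed power saving `n · s^{1+c} ≤ p` for BALANCED SDPP configurations
`|A_i| = |B_i| = s ≥ s₀` in every `ℤ/p`) refutes it.  Two displayed hypotheses, proved by the
neighbouring stubs `stub_leafPacking` / `stub_leafSwap`, are taken as data: the packing inequalities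
`na ≤ p`, `nb ≤ p`, `m·ab ≤ p`, `m·d ≤ n`, `(n−1)a + m·ab ≤ p`, `(n−1)b + m·ab ≤ p` of a clustered
family, and the `A ↔ B` swap symmetry of (SDPP + clustering).

Proof.  With `⟨c, s₀⟩` from the power gain put `K := log (27/16)`, `L := log (s₀ + 2)` and
`ε := min (c/4) (min (1/8) (7K / (16 L)))`, and take a leaf witness at `ε`; WLOG `a ≤ b` (swap).
Merit cubed and `m d ≤ n`: `p³ < m³ d² (ab)^{2+ε} ≤ m n² (ab)^{2+ε}` (P3).  If `n = 1` then
`m (ab)^{2+ε} = (m·ab) · ab · (ab)^ε ≤ p³`, absurd; so `n ≥ 2`, `n ≤ 2(n−1)`, and the refined packings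
give `na, nb ≤ 2(p − U)` with `U := m·ab ≤ p`, whence `p³ < U (na)(nb) (ab)^ε ≤ 4 U (p−U)² (ab)^ε ≤
(16/27) p³ (ab)^ε` (`27 U (p−U)² ≤ 4p³` because `4p³ − 27U(p−U)² = (p−3U)²(4p−3U)`): `(ab)^ε > 27/16`.
Also P3 and `U ≤ p` give `p² < n² (ab)^{1+ε}`.  Now pass to logarithms `π, ν, α, β` of `p, n, a, b`:
`2π < 2ν + (1+ε)(α+β)`, `ν + β ≤ π` (from `nb ≤ p`), `K < ε(α+β)`; hence `(1−ε)β < (1+ε)α`,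
`7β < 9α` (as `ε ≤ 1/8`), `7K < 16εα`, and with `16 ε L ≤ 7K`: `L < α`, i.e. `a > s₀ + 2`.  Shrink
every `B_i` to `a` elements (`IsSDPP.mono`): the power gain gives `n a^{1+c} ≤ p`, i.e.
`ν + (1+c)α ≤ π`, so `cα < ε(α+β) < (16/7) ε α ≤ (4/7) c α`, absurd since `α > 0`.

Not here: `PrimeCyclicPowerGain` (open item stmt-MatrixMultiplication-14309), the packing and swap
lemmas (neighbouring stubs), the leaf itself in either direction unconditionally.
-/

set_option linter.dupNamespace false
-- (single-conjunct summit: the namespace repeats `MatrixMultiplication`)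

namespace Summit.MatrixMultiplication.MatrixMultiplication.Theorems.HomocyclicSTPPDesigns.ClusteredCharts

open Summit.MatrixMultiplication.MatrixMultiplication.Theses.FourierTwoFamiliesModP (PrimeCyclicPowerGain)
open Literature.Computability.AlgebraicComplexity Finset
open scoped Pointwise

/-- The choice of `ε`: `0 < ε ≤ c/4`, `ε ≤ 1/8` and `16 ε log (s₀+2) ≤ 7 log (27/16)`.
[folklore] -/
private theorem leafVsPG_eps {c : ℝ} (hc : 0 < c) (s₀ : ℕ) :
    ∃ ε : ℝ, 0 < ε ∧ ε ≤ c / 4 ∧ ε ≤ 1 / 8 ∧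
      16 * ε * Real.log ((s₀ : ℝ) + 2) ≤ 7 * Real.log (27 / 16) := by
  have hK : 0 < Real.log (27 / 16) := Real.log_pos (by norm_num)
  have hL : 0 < Real.log ((s₀ : ℝ) + 2) :=
    Real.log_pos (by linarith [(Nat.cast_nonneg s₀ : (0 : ℝ) ≤ s₀)])
  refine ⟨min (c / 4) (min (1 / 8) (7 * Real.log (27 / 16) / (16 * Real.log ((s₀ : ℝ) + 2)))),
    lt_min (by positivity) (lt_min (by norm_num) (by positivity)), min_le_left _ _,
    (min_le_right _ _).trans (min_le_left _ _), ?_⟩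
  have hle : min (c / 4) (min (1 / 8) (7 * Real.log (27 / 16) / (16 * Real.log ((s₀ : ℝ) + 2))))
      ≤ 7 * Real.log (27 / 16) / (16 * Real.log ((s₀ : ℝ) + 2)) :=
    (min_le_right _ _).trans (min_le_right _ _)
  calc 16 * min (c / 4) (min (1 / 8) (7 * Real.log (27 / 16) / (16 * Real.log ((s₀ : ℝ) + 2))))
        * Real.log ((s₀ : ℝ) + 2)
      ≤ 16 * (7 * Real.log (27 / 16) / (16 * Real.log ((s₀ : ℝ) + 2)))
        * Real.log ((s₀ : ℝ) + 2) := by gcongr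
    _ = 7 * Real.log (27 / 16) := by
        field_simp

/-- Merit cubed: `P < M · D^{2/3} · X^{(2+e)/3}` gives `P³ < M³ · D² · X^{2+e}` (`P, D, X ≥ 0`).
[folklore] -/
private theorem leafVsPG_cube {P M D X e : ℝ} (hP : 0 ≤ P) (hD : 0 ≤ D) (hX : 0 ≤ X)
    (h : P < M * D ^ ((2 : ℝ) / 3) * X ^ ((2 + e) / 3)) :
    P ^ 3 < M ^ 3 * D ^ 2 * X ^ (2 + e) := by
  have h1 : P ^ 3 < (M * D ^ ((2 : ℝ) / 3) * X ^ ((2 + e) / 3)) ^ 3 :=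
    pow_lt_pow_left₀ h hP three_ne_zero
  have hD' : (D ^ ((2 : ℝ) / 3)) ^ 3 = D ^ 2 := by
    rw [← Real.rpow_natCast (D ^ ((2 : ℝ) / 3)) 3, ← Real.rpow_mul hD, ← Real.rpow_natCast D 2]
    norm_num
  have hX' : (X ^ ((2 + e) / 3)) ^ 3 = X ^ (2 + e) := by
    rw [← Real.rpow_natCast (X ^ ((2 + e) / 3)) 3, ← Real.rpow_mul hX]
    congr 1
    push_cast
    ring
  calc P ^ 3 < (M * D ^ ((2 : ℝ) / 3) * X ^ ((2 + e) / 3)) ^ 3 := h1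
    _ = M ^ 3 * (D ^ ((2 : ℝ) / 3)) ^ 3 * (X ^ ((2 + e) / 3)) ^ 3 := by rw [mul_pow, mul_pow]
    _ = M ^ 3 * D ^ 2 * X ^ (2 + e) := by rw [hD', hX']

/-- Step 3 (the blocks are large), pure polynomial arithmetic: if `N ≥ 2`, `0 ≤ U ≤ P`, `P > 0`,
`(N−1)A + U ≤ P`, `(N−1)B + U ≤ P` (`A, B ≥ 0`) and `P³ < U · (NA) · (NB) · E` (`E ≥ 0`), then
`27 < 16 E`: indeed `NA, NB ≤ 2(P − U)` and `27 U (P−U)² ≤ 4 P³` since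
`4P³ − 27U(P−U)² = (P − 3U)²(4P − 3U)`. [folklore] -/
private theorem leafVsPG_step3 {P N U A B E : ℝ} (hP : 0 < P) (hN : 2 ≤ N) (hA : 0 ≤ A)
    (hB : 0 ≤ B) (hU : 0 ≤ U) (hUP : U ≤ P) (hE : 0 ≤ E)
    (h5 : (N - 1) * A + U ≤ P) (h6 : (N - 1) * B + U ≤ P)
    (h : P ^ 3 < U * (N * A) * (N * B) * E) : 27 < 16 * E := by
  have hNA : N * A ≤ 2 * (P - U) := by nlinarith [mul_nonneg (by linarith : (0 : ℝ) ≤ N - 2) hA]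
  have hNB : N * B ≤ 2 * (P - U) := by nlinarith [mul_nonneg (by linarith : (0 : ℝ) ≤ N - 2) hB]
  have hPU : 0 ≤ P - U := by linarith
  have hN0 : 0 ≤ N := by linarith
  have hprod : (N * A) * (N * B) ≤ (2 * (P - U)) * (2 * (P - U)) :=
    mul_le_mul hNA hNB (mul_nonneg hN0 hB) (by linarith)
  have hcubic : 27 * (U * (P - U) ^ 2) ≤ 4 * P ^ 3 := by
    nlinarith [mul_nonneg (sq_nonneg (P - 3 * U)) (show (0 : ℝ) ≤ 4 * P - 3 * U by linarith)]
  have h1 : P ^ 3 < U * (4 * (P - U) ^ 2) * E :=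
    calc P ^ 3 < U * (N * A) * (N * B) * E := h
      _ = U * ((N * A) * (N * B)) * E := by ring
      _ ≤ U * ((2 * (P - U)) * (2 * (P - U))) * E := by gcongr
      _ = U * (4 * (P - U) ^ 2) * E := by ring
  have h2 : 27 * P ^ 3 < 16 * P ^ 3 * E := by
    have h3 : 27 * (U * (P - U) ^ 2) * E ≤ 4 * P ^ 3 * E := mul_le_mul_of_nonneg_right hcubic hE
    nlinarith [h3, h1]
  by_contra hcon
  push Not at hcon
  have h4 : P ^ 3 * (16 * E) ≤ P ^ 3 * 27 := mul_le_mul_of_nonneg_left hcon (pow_pos hP 3).le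
  nlinarith [h4, h2]

/-- Steps 4–5 in logarithms, pure linear-by-parts arithmetic: from `2π < 2ν + (1+ε)(α+β)`,
`ν + β ≤ π`, `K < ε(α+β)`, `16 ε L ≤ 7 K`, `0 ≤ α`, `0 ≤ β`, `0 < ε ≤ 1/8` one gets `L < α`; and if
moreover `ν + (1+c)α ≤ π` with `ε ≤ c/4` and `0 < α`, a contradiction. [folklore] -/
private theorem leafVsPG_logStep {π ν α β ε c K L : ℝ} (hε : 0 < ε) (hεc : ε ≤ c / 4)
    (hε8 : ε ≤ 1 / 8) (hεs : 16 * ε * L ≤ 7 * K) (hα : 0 ≤ α) (hβ : 0 ≤ β)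
    (h1 : 2 * π < 2 * ν + (1 + ε) * (α + β)) (h2 : ν + β ≤ π) (h3 : K < ε * (α + β)) :
    L < α ∧ (0 < α → ν + (1 + c) * α ≤ π → False) := by
  have hL9 : (1 - ε) * β < (1 + ε) * α := by linarith
  have hL10 : 7 * β < 9 * α := by
    nlinarith [mul_nonneg (show (0 : ℝ) ≤ 1 / 8 - ε by linarith) (add_nonneg hα hβ)]
  have hprod1 : ε * (7 * β) < ε * (9 * α) := mul_lt_mul_of_pos_left hL10 hε
  refine ⟨?_, fun hαpos hgain => ?_⟩
  · -- `16 ε L ≤ 7 K < 7 ε (α + β) < 16 ε α`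
    by_contra hcon
    push Not at hcon
    have h4 : ε * α ≤ ε * L := mul_le_mul_of_nonneg_left hcon hε.le
    nlinarith [h4, hprod1, h3, hεs]
  · have hL14 : c * α < ε * α + ε * β := by linarith
    have hprod2 : 0 < (7 * c - 16 * ε) * α := mul_pos (by linarith) hαpos
    nlinarith [hprod1, hprod2, hL14]

/-- The arithmetic of the refutation (Steps 2–5 of the proof, everything cast to `ℝ` once): the
packing inequalities, the merit at the chosen `ε`, `a ≤ b`, and the conditional power gain
`s₀ ≤ a → n · a^{1+c} ≤ p` are contradictory. [folklore] -/
private theorem leafVsPG_arith {c ε : ℝ} {s₀ p n m a b d : ℕ} (hε : 0 < ε)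
    (hεc : ε ≤ c / 4) (hε8 : ε ≤ 1 / 8)
    (hεs : 16 * ε * Real.log ((s₀ : ℝ) + 2) ≤ 7 * Real.log (27 / 16))
    (hp : 2 ≤ p) (ha : 1 ≤ a) (hle : a ≤ b) (hm : 1 ≤ m) (hd : 1 ≤ d)
    (h2 : n * b ≤ p) (h3 : m * (a * b) ≤ p) (h4 : m * d ≤ n)
    (h5 : (n - 1) * a + m * (a * b) ≤ p) (h6 : (n - 1) * b + m * (a * b) ≤ p)
    (hmerit : (p : ℝ) < (m : ℝ) * (d : ℝ) ^ ((2 : ℝ) / 3) * ((a * b : ℕ) : ℝ) ^ ((2 + ε) / 3))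
    (hgain : s₀ ≤ a → (n : ℝ) * (a : ℝ) ^ (1 + c) ≤ p) : False := by
  -- casts
  have hb : 1 ≤ b := le_trans ha hle
  have hn : 1 ≤ n := le_trans (Nat.mul_le_mul hm hd) h4
  have hP : (2 : ℝ) ≤ p := by exact_mod_cast hp
  have hP0 : (0 : ℝ) < p := by linarith
  have hA : (1 : ℝ) ≤ a := by exact_mod_cast ha
  have hB : (1 : ℝ) ≤ b := by exact_mod_cast hb
  have hAB : (a : ℝ) ≤ b := by exact_mod_cast hle
  have hM : (1 : ℝ) ≤ m := by exact_mod_cast hm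
  have hN : (1 : ℝ) ≤ n := by exact_mod_cast hn
  have h2' : (n : ℝ) * b ≤ p := by exact_mod_cast h2
  have h3' : (m : ℝ) * (a * b) ≤ p := by exact_mod_cast h3
  have h4' : (m : ℝ) * d ≤ n := by exact_mod_cast h4
  have hsub : ((n - 1 : ℕ) : ℝ) = (n : ℝ) - 1 := by rw [Nat.cast_sub hn, Nat.cast_one]
  have h5' : ((n : ℝ) - 1) * a + m * (a * b) ≤ p := by rw [← hsub]; exact_mod_cast h5
  have h6' : ((n : ℝ) - 1) * b + m * (a * b) ≤ p := by rw [← hsub]; exact_mod_cast h6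
  have hX1 : (1 : ℝ) ≤ (a : ℝ) * b := by nlinarith
  have hX0 : (0 : ℝ) < (a : ℝ) * b := by linarith
  have hmerit' : (p : ℝ) < m * (d : ℝ) ^ ((2 : ℝ) / 3) * ((a : ℝ) * b) ^ ((2 + ε) / 3) := by
    rwa [Nat.cast_mul] at hmerit
  have hE0 : (0 : ℝ) ≤ ((a : ℝ) * b) ^ ε := Real.rpow_nonneg hX0.le ε
  -- Step 2: merit cubed, `p³ < m n² (ab)² (ab)^ε`
  have hM1 : (p : ℝ) ^ 3 < m * (n : ℝ) ^ 2 * (((a : ℝ) * b) ^ 2 * ((a : ℝ) * b) ^ ε) := by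
    have hc := leafVsPG_cube hP0.le (Nat.cast_nonneg d) hX0.le hmerit'
    have hsplit : ((a : ℝ) * b) ^ (2 + ε) = ((a : ℝ) * b) ^ 2 * ((a : ℝ) * b) ^ ε := by
      rw [Real.rpow_add hX0, Real.rpow_two]
    have hmn : (m : ℝ) ^ 3 * (d : ℝ) ^ 2 ≤ m * (n : ℝ) ^ 2 := by
      have hmd0 : 0 ≤ (m : ℝ) * d := by positivity
      calc (m : ℝ) ^ 3 * (d : ℝ) ^ 2 = m * ((m : ℝ) * d) ^ 2 := by ring
        _ ≤ m * (n : ℝ) ^ 2 := by gcongr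
    calc (p : ℝ) ^ 3 < (m : ℝ) ^ 3 * (d : ℝ) ^ 2 * ((a : ℝ) * b) ^ (2 + ε) := hc
      _ ≤ m * (n : ℝ) ^ 2 * ((a : ℝ) * b) ^ (2 + ε) := by gcongr
      _ = m * (n : ℝ) ^ 2 * (((a : ℝ) * b) ^ 2 * ((a : ℝ) * b) ^ ε) := by rw [hsplit]
  -- `p² < n² (ab)^{1+ε}`
  have hP2 : (p : ℝ) ^ 2 < (n : ℝ) ^ 2 * ((a : ℝ) * b) ^ (1 + ε) := by
    have hsplit1 : ((a : ℝ) * b) ^ (1 + ε) = ((a : ℝ) * b) * ((a : ℝ) * b) ^ ε := by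
      rw [Real.rpow_add hX0, Real.rpow_one]
    have hle1 : (m : ℝ) * (n : ℝ) ^ 2 * (((a : ℝ) * b) ^ 2 * ((a : ℝ) * b) ^ ε) ≤
        p * ((n : ℝ) ^ 2 * ((a : ℝ) * b) ^ (1 + ε)) := by
      rw [hsplit1]
      calc (m : ℝ) * (n : ℝ) ^ 2 * (((a : ℝ) * b) ^ 2 * ((a : ℝ) * b) ^ ε)
          = ((m : ℝ) * (a * b)) * ((n : ℝ) ^ 2 * ((a : ℝ) * b * ((a : ℝ) * b) ^ ε)) := by ring
        _ ≤ p * ((n : ℝ) ^ 2 * ((a : ℝ) * b * ((a : ℝ) * b) ^ ε)) := by gcongr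
    have hlt : (p : ℝ) * (p : ℝ) ^ 2 < p * ((n : ℝ) ^ 2 * ((a : ℝ) * b) ^ (1 + ε)) := by
      have h33 : (p : ℝ) * (p : ℝ) ^ 2 = (p : ℝ) ^ 3 := by ring
      rw [h33]
      exact hM1.trans_le hle1
    exact lt_of_mul_lt_mul_left hlt hP0.le
  -- Step 3: `27 < 16 (ab)^ε`
  have h27 : (27 : ℝ) < 16 * ((a : ℝ) * b) ^ ε := by
    rcases eq_or_lt_of_le hn with hn1 | hn2
    · -- `n = 1` is impossible
      exfalso
      have hN1 : (n : ℝ) = 1 := by exact_mod_cast hn1.symm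
      rw [hN1] at hM1
      have hXε : ((a : ℝ) * b) ^ ε ≤ (a : ℝ) * b :=
        calc ((a : ℝ) * b) ^ ε ≤ ((a : ℝ) * b) ^ (1 : ℝ) :=
              Real.rpow_le_rpow_of_exponent_le hX1 (by linarith)
          _ = (a : ℝ) * b := Real.rpow_one _
      have hXP : (a : ℝ) * b ≤ p := le_trans (le_mul_of_one_le_left hX0.le hM) h3'
      have hXεP : ((a : ℝ) * b) ^ ε ≤ p := hXε.trans hXP
      have hle3 : (m : ℝ) * (1 : ℝ) ^ 2 * (((a : ℝ) * b) ^ 2 * ((a : ℝ) * b) ^ ε) ≤ (p : ℝ) ^ 3 :=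
        calc (m : ℝ) * (1 : ℝ) ^ 2 * (((a : ℝ) * b) ^ 2 * ((a : ℝ) * b) ^ ε)
            = ((m : ℝ) * (a * b)) * ((a : ℝ) * b) * ((a : ℝ) * b) ^ ε := by ring
          _ ≤ (p : ℝ) * p * p := by gcongr
          _ = (p : ℝ) ^ 3 := by ring
      linarith
    · have hN2 : (2 : ℝ) ≤ n := by exact_mod_cast hn2
      refine leafVsPG_step3 hP0 hN2 (by linarith) (by linarith) (by positivity) h3' hE0 h5' h6' ?_
      calc (p : ℝ) ^ 3 < m * (n : ℝ) ^ 2 * (((a : ℝ) * b) ^ 2 * ((a : ℝ) * b) ^ ε) := hM1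
        _ = (m : ℝ) * (a * b) * (n * a) * (n * b) * ((a : ℝ) * b) ^ ε := by ring
  -- Step 4: logarithms
  have hA0 : (0 : ℝ) < a := by linarith
  have hB0 : (0 : ℝ) < b := by linarith
  have hN0 : (0 : ℝ) < n := by linarith
  have hlogab : Real.log ((a : ℝ) * b) = Real.log a + Real.log b :=
    Real.log_mul hA0.ne' hB0.ne'
  have hL1 : 2 * Real.log p < 2 * Real.log n + (1 + ε) * (Real.log a + Real.log b) := by
    have h := Real.log_lt_log (pow_pos hP0 2) hP2
    rw [Real.log_pow, Real.log_mul (pow_pos hN0 2).ne' (Real.rpow_pos_of_pos hX0 _).ne',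
      Real.log_pow, Real.log_rpow hX0, hlogab] at h
    exact_mod_cast h
  have hL2 : Real.log n + Real.log b ≤ Real.log p := by
    have h := Real.log_le_log (mul_pos hN0 hB0) h2'
    rwa [Real.log_mul hN0.ne' hB0.ne'] at h
  have hL3 : Real.log (27 / 16) < ε * (Real.log a + Real.log b) := by
    have h' : (27 : ℝ) / 16 < ((a : ℝ) * b) ^ ε := by
      rw [div_lt_iff₀ (by norm_num : (0 : ℝ) < 16)]
      linarith
    have h := Real.log_lt_log (by norm_num) h'
    rwa [Real.log_rpow hX0, hlogab] at h
  obtain ⟨hLα, hfin⟩ := leafVsPG_logStep hε hεc hε8 hεs (Real.log_nonneg hA) (Real.log_nonneg hB)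
    hL1 hL2 hL3
  -- `a > s₀ + 2`
  have hs₀2 : (s₀ : ℝ) + 2 < a :=
    (Real.log_lt_log_iff (by positivity) hA0).1 hLα
  have hs₀a : s₀ ≤ a := by
    have h : ((s₀ + 2 : ℕ) : ℝ) < a := by push_cast; exact hs₀2
    have h' := Nat.cast_lt.1 h
    omega
  have hαpos : 0 < Real.log a :=
    Real.log_pos (by linarith [(Nat.cast_nonneg s₀ : (0 : ℝ) ≤ s₀)])
  -- Step 5: the power gain
  have hg := hgain hs₀a
  have hL4 : Real.log n + (1 + c) * Real.log a ≤ Real.log p := by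
    have h := Real.log_le_log (mul_pos hN0 (Real.rpow_pos_of_pos hA0 _)) hg
    rwa [Real.log_mul hN0.ne' (Real.rpow_pos_of_pos hA0 _).ne', Real.log_rpow hA0] at h
  exact hfin hαpos hL4

/-- The combinatorial core, for `a ≤ b`: a leaf witness at the chosen `ε` contradicts the power
gain — shrink every `B_i` to `a` elements (`Finset.exists_subset_card_eq`, `IsSDPP.mono`) to get a
balanced SDPP configuration with `s = a ≥ s₀`, and feed `n · a^{1+c} ≤ p` to `leafVsPG_arith`.
[folklore] -/
private theorem leafVsPG_core {c ε : ℝ} {s₀ : ℕ} (hε : 0 < ε) (hεc : ε ≤ c / 4)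
    (hε8 : ε ≤ 1 / 8) (hεs : 16 * ε * Real.log ((s₀ : ℝ) + 2) ≤ 7 * Real.log (27 / 16))
    (hPG : ∀ p : ℕ, p.Prime → ∀ (n s : ℕ) (A B : Fin n → Finset (ZMod p)), s₀ ≤ s →
      (∀ i : Fin n, (A i).card = s ∧ (B i).card = s) →
      (∀ i : Fin n, ∀ a ∈ A i, ∀ a' ∈ A i, ∀ b ∈ B i, ∀ b' ∈ B i,
        (a - a') + (b - b') = 0 → a = a' ∧ b = b') →
      (∀ i j k : Fin n, ∀ a ∈ A i, ∀ a' ∈ A j, ∀ b ∈ B j, ∀ b' ∈ B k,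
        (a - a') + (b - b') = 0 → i = k) →
      (n : ℝ) * (s : ℝ) ^ (1 + c) ≤ (p : ℝ))
    (hPack : ∀ (p n m a b d : ℕ), p.Prime → ∀ (A B : Fin n → Finset (ZMod p))
      (cls : Fin n → Fin m),
      IsSDPP A B → 1 ≤ a → 1 ≤ b → (∀ i, (A i).card = a ∧ (B i).card = b) →
      (∀ i j, cls i ≠ cls j → Disjoint (A i - B i) (A j - B j)) →
      1 ≤ d → (∀ c : Fin m, d ≤ (Finset.univ.filter fun i => cls i = c).card) →
      n * a ≤ p ∧ n * b ≤ p ∧ m * (a * b) ≤ p ∧ m * d ≤ n ∧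
      (n - 1) * a + m * (a * b) ≤ p ∧ (n - 1) * b + m * (a * b) ≤ p)
    {p n m a b d : ℕ} (hp : p.Prime) {A B : Fin n → Finset (ZMod p)} {cls : Fin n → Fin m}
    (hS : IsSDPP A B) (hab : 2 ≤ a * b) (hle : a ≤ b)
    (hcard : ∀ i, (A i).card = a ∧ (B i).card = b)
    (hclust : ∀ i j, cls i ≠ cls j → Disjoint (A i - B i) (A j - B j))
    (hsize : ∀ c : Fin m, d ≤ (Finset.univ.filter fun i => cls i = c).card)
    (hmerit : (p : ℝ) < (m : ℝ) * (d : ℝ) ^ ((2 : ℝ) / 3) * ((a * b : ℕ) : ℝ) ^ ((2 + ε) / 3)) :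
    False := by
  have ha : 1 ≤ a := Nat.pos_of_ne_zero fun h => by simp [h] at hab
  have hb : 1 ≤ b := Nat.pos_of_ne_zero fun h => by simp [h] at hab
  have hm : 1 ≤ m := Nat.pos_of_ne_zero fun h => by
    rw [h, Nat.cast_zero, zero_mul, zero_mul] at hmerit
    exact not_lt.2 (Nat.cast_nonneg _) hmerit
  have hd : 1 ≤ d := Nat.pos_of_ne_zero fun h => by
    rw [h, Nat.cast_zero, Real.zero_rpow (by norm_num), mul_zero, zero_mul] at hmerit
    exact not_lt.2 (Nat.cast_nonneg _) hmerit
  obtain ⟨-, h2, h3, h4, h5, h6⟩ := hPack p n m a b d hp A B cls hS ha hb hcard hclust hd hsize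
  refine leafVsPG_arith hε hεc hε8 hεs hp.two_le ha hle hm hd h2 h3 h4 h5 h6 hmerit ?_
  intro hs₀
  -- shrink every `B i` to `a` elements
  have hex : ∀ i, ∃ t ⊆ B i, t.card = a := fun i =>
    Finset.exists_subset_card_eq (by rw [(hcard i).2]; exact hle)
  choose B' hB'sub hB'card using hex
  have hS' : IsSDPP A B' := hS.mono (fun _ => Finset.Subset.rfl) hB'sub
  exact hPG p hp n a A B' hs₀ (fun i => ⟨(hcard i).1, hB'card i⟩) hS'.1 hS'.2

/-- **`PrimeCyclicPowerGain` refutes the clustered two-families leaf** (registered stub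
`stub_leafVersusPowerGain` of line `registered`, clustered-charts reshape, kill-side calibration;
size L).  Hypotheses, in order: the packing inequalities of a clustered SDPP family
(`stub_leafPacking`), the `A ↔ B` swap symmetry (`stub_leafSwap`), and the OPEN kill item
`PrimeCyclicPowerGain` (stmt-MatrixMultiplication-14309: `n · s^{1+c} ≤ p` for balanced SDPP
configurations with `s ≥ s₀`).  Conclusion: the leaf (clustered SDPP families in `ℤ/p` with merit
`m · d^{2/3} · (ab)^{(2+ε)/3} > p` for every `ε > 0`) fails.  Proof: take a witness at
`ε := min (c/4) (min (1/8) (7 log(27/16) / (16 log(s₀+2))))`, WLOG `a ≤ b`; merit cubed + packing give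
`p³ < m n² (ab)^{2+ε}`, `(ab)^ε > 27/16`, `p² < n²(ab)^{1+ε}`, hence (logs) `b^{1−ε} < a^{1+ε}`,
`b < a^{9/7}`, `a > s₀ + 2`; shrinking the `B_i` to size `a`, the power gain `n a^{1+c} ≤ p` forces
`c < 16ε/7 ≤ 4c/7`, absurd. [folklore] -/
theorem stub_leafVersusPowerGain :
    (∀ (p n m a b d : ℕ), p.Prime → ∀ (A B : Fin n → Finset (ZMod p)) (cls : Fin n → Fin m),
      IsSDPP A B → 1 ≤ a → 1 ≤ b → (∀ i, (A i).card = a ∧ (B i).card = b) →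
      (∀ i j, cls i ≠ cls j → Disjoint (A i - B i) (A j - B j)) →
      1 ≤ d → (∀ c : Fin m, d ≤ (Finset.univ.filter fun i => cls i = c).card) →
      n * a ≤ p ∧ n * b ≤ p ∧ m * (a * b) ≤ p ∧ m * d ≤ n ∧
      (n - 1) * a + m * (a * b) ≤ p ∧ (n - 1) * b + m * (a * b) ≤ p) →
    (∀ (p n m : ℕ) (A B : Fin n → Finset (ZMod p)) (cls : Fin n → Fin m),
      IsSDPP A B → (∀ i j, cls i ≠ cls j → Disjoint (A i - B i) (A j - B j)) →
      IsSDPP B A ∧ (∀ i j, cls i ≠ cls j → Disjoint (B i - A i) (B j - A j))) →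
    PrimeCyclicPowerGain →
    ¬ ∀ ε : ℝ, 0 < ε → ∃ p : ℕ, p.Prime ∧ ∃ (n m a b d : ℕ) (A B : Fin n → Finset (ZMod p))
      (cls : Fin n → Fin m), IsSDPP A B ∧ 2 ≤ a * b ∧ (∀ i, (A i).card = a ∧ (B i).card = b) ∧
      (∀ i j, cls i ≠ cls j → Disjoint (A i - B i) (A j - B j)) ∧
      (∀ c : Fin m, d ≤ (Finset.univ.filter fun i => cls i = c).card) ∧
      (p : ℝ) < (m : ℝ) * (d : ℝ) ^ ((2 : ℝ) / 3) * ((a * b : ℕ) : ℝ) ^ ((2 + ε) / 3) := by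
  intro hPack hSwap hPG hLeaf
  obtain ⟨c, hc, s₀, hPG⟩ := hPG
  obtain ⟨ε, hε, hεc, hε8, hεs⟩ := leafVsPG_eps hc s₀
  obtain ⟨p, hp, n, m, a, b, d, A, B, cls, hS, hab, hcard, hclust, hsize, hmerit⟩ := hLeaf ε hε
  rcases le_total a b with hle | hle
  · exact leafVsPG_core hε hεc hε8 hεs hPG hPack hp hS hab hle hcard hclust hsize hmerit
  · obtain ⟨hS', hclust'⟩ := hSwap p n m A B cls hS hclust
    refine leafVsPG_core hε hεc hε8 hεs hPG hPack hp hS' (by rwa [Nat.mul_comm]) hle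
      (fun i => ⟨(hcard i).2, (hcard i).1⟩) hclust' hsize ?_
    rwa [Nat.mul_comm]

end Summit.MatrixMultiplication.MatrixMultiplication.Theorems.HomocyclicSTPPDesigns.ClusteredCharts
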